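import Literature.NumberTheory.Automorphic.FuchsianIncompleteEisenstein
import Literature.NumberTheory.Automorphic.FuchsianCuspidalSubspace
import Literature.NumberTheory.Automorphic.IncompleteEisensteinPlancherel

/-!
# Incomplete Eisenstein series at an arbitrary cusp, Lemma 3.3 there, and the Mellin representation (7.2)
(Iwaniec, *Spectral Methods of Automorphic Forms*, GSM 53, §3.2 (3.12)–(3.16) & Lemma 3.3 (3.14),
PDF pp. 43–44; Chapter 7, (7.1)–(7.3), PDF pp. 73–74)

Fifth brick of the series `FuchsianGroupCusps` / `FuchsianEisensteinSeries` /
`FuchsianIncompleteEisenstein` / `FuchsianEisensteinGrowth` towards the general finite-volume cases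
of `Iwaniec2002_thm_7_4` / `Iwaniec2002_eq_12_5` / `Iwaniec2002_thm_12_1` (the continuous spectrum:
the space `𝓔(Γ\ℍ)` spanned by the incomplete Eisenstein series of ALL cusps, Theorem 7.3). For a
GENERAL discrete `Γ ≤ SL₂(ℝ)` (inside `GL₂(ℝ)`) and a scaling matrix `σ` of a cusp `𝔞 = σ∞` with
`σ⁻¹Γ_𝔞σ = B` (`Fuchsian.exists_scaling`, `FuchsianCuspZones.exists_cuspSystem`), everything PROVED,
nothing vendored, no fact introduced:

1. (§1) **`E_𝔞(z|ψ) = incEisCusp Γ σ ψ z = E^{σ⁻¹Γσ}(σ⁻¹z|ψ)`** ((3.12) at the cusp `𝔞`, through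
   `Fuchsian.incEis` of the conjugate group; companion of `eisCusp` and of `Fuchsian.cuspMeanAt`):
   `Γ`-automorphic for every `ψ` (`incEisCusp_smul`), continuous and bounded by `‖ψ‖_∞(1 + 36/a)`
   for `ψ` vanishing on `(-∞, a)` (`continuous_incEisCusp`, `norm_incEisCusp_le`); **in the zone of
   `𝔞` it IS its constant term**: `E_𝔞(z|ψ) = ψ(Im σ⁻¹z)` for `Im σ⁻¹z > 1/a` (`incEis_eq_of_lt_im`,
   `incEisCusp_eq_of_lt_im`; `-1 ∈ Γ`) and `= 0` for `Im σ⁻¹z > max b (1/a)`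
   (`incEisCusp_eq_zero_of_lt_im`) — the identities behind truncation by constant terms ((6.29)).
2. (§1) **Lemma 3.3 at the cusp `𝔞`** (`setIntegral_incEisCusp_mul`): for `F` a fundamental domain of
   `Γ` (`-1 ∈ Γ`), `ψ` continuous supported in `[a, b] ⊆ (0, ∞)`, `f` automorphic and continuous,
   `∫_F E_𝔞(z|ψ) f(z) dμ = ∫₀^∞ ψ(y) f_𝔞(y) y⁻² dy` with `f_𝔞 = cuspMeanAt σ f` the zero-th Fourier
   coefficient at `𝔞` ((3.2)–(3.4)); pointwise form `Σ_{γ ∈ Γ} 𝟙_P(σ⁻¹γz)ψ(Im σ⁻¹γz)f(γz) = 2E_𝔞(z|ψ)f(z)`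
   (`tsum_strip_smul_eq_cusp`, reindexing `Γ ≃ σ⁻¹Γσ`, `conjEquiv`), then the unfolding
   `∫_F Σ_γ φ(γz) = 2∫_ℍ φ` of `FundamentalDomainUnfolding` for the fundamental domain of `Γ` itself and
   the invariance of `dμ` under `σ` (`integral_comp_sl_inv_smul`) — no transport of fundamental domains.
   With (1) this is what identifies the cusp forms of `FuchsianCuspidalSubspace` (vanishing
   `cuspMeanAt σᵢ` at every cusp) with `𝓔(Γ\ℍ)^⊥` ((3.15)).
3. (§2) **The Mellin representation (7.2)** (`incEis_eq_integral_mellin`,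
   `incEisCusp_eq_integral_mellin`): for a smooth bump `ψ` (`IsSmoothBump`) and `c > 1`,
   `E_𝔞(z|ψ) = (1/2πi) ∫_{(c)} ψ̂(s) E_𝔞(z, s) ds = (1/2π) ∫_ℝ Mψ(-c + iτ) E_𝔞(z, c - iτ) dτ`,
   `ψ̂(s) = Mψ(-s)` (Mathlib's `mellin`), by Mellin inversion on `Re = -c`
   (`IsSmoothBump.mellin_inversion`) and the absolutely convergent interchange ((7.3) =
   `IsSmoothBump.verticalIntegrable_mellin`, and `summable_rowIm_rpow`) — the contour integral from
   which the spectral expansion (7.12) of `E_𝔞(z|ψ)` emerges once `E_𝔞(z, s)` is continued.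

## References
* [Iwaniec2002] H. Iwaniec, *Spectral Methods of Automorphic Forms*, 2nd ed., GSM 53, AMS 2002,
  §3.2 (3.12)–(3.16) & Lemma 3.3, PDF pp. 43–44; §7 (7.1)–(7.3), PDF pp. 73–74; (6.29), PDF p. 88
  (held copy `book:iwaniec2002-spectral-methods-automorphic-forms`).

Mathlib: `mellin`, `mellinInv_mellin_eq` (through `IsSmoothBump.mellin_inversion`),
`MeasureTheory.integral_tsum_of_summable_integral_norm`, `Integrable.mul_bdd`,
`MeasurePreserving.integral_comp`, `MeasurableEquiv.smul`, `Equiv.tsum_eq`, `tsum_eq_sum`.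
Literature: `incEis`, `incEis_smul`, `continuous_incEis`, `norm_incEis_le`, `incEis_eq_zero_of_lt_im`,
`rowIm_le_inv_im`, `tsum_strip_smul_eq`, `integrable_strip_mul`, `integral_strip_mul_eq`
(`FuchsianIncompleteEisenstein`); `eisInfty`, `eisTerm`, `eisCusp` (`FuchsianEisensteinSeries`);
`rows`, `rowIm`, `apply_one_eq_of_mem_rows`, `mem_conj_inv_iff`, `neg_one_mem_conj_iff`,
`conj_le_range`, `IsDiscreteSubgroup.conj`, `summable_rowIm_rpow` (`FuchsianGroupCusps`);
`cuspStrip`, `upperRightHom_one_mem_of_periods` (`FuchsianCuspZones`); `cuspMeanAt`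
(`FuchsianCuspidalSubspace`); `IsSmoothBump`, `cplx`, `IsSmoothBump.mellin_inversion`,
`IsSmoothBump.verticalIntegrable_mellin` (`IncompleteEisensteinPlancherel`);
`setIntegral_tsum_smul_eq`, `integrable_comp_smul` (`FundamentalDomainUnfolding`); `toGL_smul_eq`
(`InvariantIntegralOperators`). Nothing on
incomplete Eisenstein series at a general cusp or on (7.2) existed
(`lean search 'incEisCusp|incEis.*mellin|mellin.*eisInfty|Lemma 3.3 at'`: no hits; the modular file
`IncompleteEisensteinSeries.lean` treats the single cusp of `SL₂(ℤ)`).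
-/

noncomputable section

namespace Literature.NumberTheory.Automorphic

open Matrix UpperHalfPlane
open scoped MatrixGroups

namespace Fuchsian

variable {Γ : Subgroup (GL (Fin 2) ℝ)}

section Cusp

open _root_.MeasureTheory _root_.Set _root_.Filter
open scoped _root_.Pointwise _root_.ENNReal _root_.Topology

variable (Γ) in
/-- **The incomplete Eisenstein series of the cusp `𝔞 = σ∞`** with scaling matrix `σ` ((3.12)):
`E_𝔞(z|ψ) = Σ_{γ ∈ Γ_𝔞\Γ} ψ(Im σ⁻¹γz) = E^{σ⁻¹Γσ}(σ⁻¹z|ψ)` (the series of the cusp `∞` of the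
conjugate group `σ⁻¹Γσ`, `Fuchsian.incEis`, at `σ⁻¹z`; cf. `eisCusp`). [cite: Iwaniec2002, §3.2 (3.12), PDF p. 43] -/
def incEisCusp (σ : SL(2, ℝ)) (ψ : ℝ → ℂ) (z : ℍ) : ℂ :=
  incEis (ConjAct.toConjAct (Matrix.SpecialLinearGroup.toGL σ : GL (Fin 2) ℝ)⁻¹ • Γ) ψ (σ⁻¹ • z)

/-- With `σ = 1` this is `E(z|ψ)`. [folklore] -/
theorem incEisCusp_one (ψ : ℝ → ℂ) (z : ℍ) : incEisCusp Γ 1 ψ z = incEis Γ ψ z := by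
  simp [incEisCusp]

/-- **Automorphy**: `E_𝔞(γz|ψ) = E_𝔞(z|ψ)` for `γ ∈ Γ`, every `ψ`. [cite: Iwaniec2002, §3.1 (3.1) & §3.2 (3.12), PDF pp. 40, 43] -/
theorem incEisCusp_smul
    (hΓ : Γ ≤ (Matrix.SpecialLinearGroup.toGL : SL(2, ℝ) →* GL (Fin 2) ℝ).range)
    (σ : SL(2, ℝ)) (ψ : ℝ → ℂ) {δ : GL (Fin 2) ℝ} (hδ : δ ∈ Γ) (z : ℍ) :
    incEisCusp Γ σ ψ (δ • z) = incEisCusp Γ σ ψ z := by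
  set S : GL (Fin 2) ℝ := Matrix.SpecialLinearGroup.toGL σ with hS
  set Γ' : Subgroup (GL (Fin 2) ℝ) := ConjAct.toConjAct S⁻¹ • Γ with hΓ'
  have hΓ'le : Γ' ≤ (Matrix.SpecialLinearGroup.toGL : SL(2, ℝ) →* GL (Fin 2) ℝ).range := by
    rw [hΓ', hS, ← map_inv]; exact conj_le_range hΓ σ⁻¹
  have hmem : S⁻¹ * δ * S ∈ Γ' := by
    rw [hΓ', mem_conj_inv_iff]
    simpa [mul_assoc] using hδ
  have e1 : ∀ w : ℍ, σ⁻¹ • w = S⁻¹ • w := fun w => by rw [hS, ← map_inv]; rfl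
  have e : σ⁻¹ • δ • z = (S⁻¹ * δ * S) • (σ⁻¹ • z) := by
    rw [e1, e1, mul_smul, mul_smul, smul_inv_smul]
  show incEis Γ' ψ (σ⁻¹ • δ • z) = incEis Γ' ψ (σ⁻¹ • z)
  rw [e]
  exact incEis_smul hΓ'le hmem ψ _

/-- `E_𝔞(·|ψ)` is `Γ`-automorphic. [cite: Iwaniec2002, §3.2 (3.12), PDF p. 43] -/
theorem isAutomorphic_incEisCusp
    (hΓ : Γ ≤ (Matrix.SpecialLinearGroup.toGL : SL(2, ℝ) →* GL (Fin 2) ℝ).range)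
    (σ : SL(2, ℝ)) (ψ : ℝ → ℂ) : IsAutomorphic Γ (incEisCusp Γ σ ψ) :=
  fun _ hδ z => incEisCusp_smul hΓ σ ψ hδ z

/-- **Continuity of `E_𝔞(·|ψ)`** for continuous `ψ` vanishing near `0` (width-one scaling).
[cite: Iwaniec2002, §3.2, PDF p. 43] -/
theorem continuous_incEisCusp
    (hΓ : Γ ≤ (Matrix.SpecialLinearGroup.toGL : SL(2, ℝ) →* GL (Fin 2) ℝ).range)
    (hd : IsDiscreteSubgroup Γ) (σ : SL(2, ℝ))
    (hper : (ConjAct.toConjAct (Matrix.SpecialLinearGroup.toGL σ : GL (Fin 2) ℝ)⁻¹ • Γ).strictPeriods =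
      AddSubgroup.zmultiples 1)
    {ψ : ℝ → ℂ} {a : ℝ} (hψc : Continuous ψ) (hψ : ∀ t < a, ψ t = 0) (ha : 0 < a) :
    Continuous (incEisCusp Γ σ ψ) := by
  have hle : ConjAct.toConjAct (Matrix.SpecialLinearGroup.toGL σ : GL (Fin 2) ℝ)⁻¹ • Γ ≤
      (Matrix.SpecialLinearGroup.toGL : SL(2, ℝ) →* GL (Fin 2) ℝ).range := by
    rw [← map_inv]; exact conj_le_range hΓ σ⁻¹
  exact (continuous_incEis hle (hd.conj _) (upperRightHom_one_mem_of_periods hper)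
    hψc hψ ha).comp (continuous_const_smul _)

/-- **Bound**: `|E_𝔞(z|ψ)| ≤ B(1 + 36/a)` if `|ψ| ≤ B` and `ψ = 0` on `(-∞, a)`. [cite: Iwaniec2002, Lemma 2.10 & §3.2, PDF pp. 38, 43] -/
theorem norm_incEisCusp_le
    (hΓ : Γ ≤ (Matrix.SpecialLinearGroup.toGL : SL(2, ℝ) →* GL (Fin 2) ℝ).range)
    (hd : IsDiscreteSubgroup Γ) (σ : SL(2, ℝ))
    (hper : (ConjAct.toConjAct (Matrix.SpecialLinearGroup.toGL σ : GL (Fin 2) ℝ)⁻¹ • Γ).strictPeriods =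
      AddSubgroup.zmultiples 1)
    {ψ : ℝ → ℂ} {a B : ℝ} (hψ : ∀ t < a, ψ t = 0) (ha : 0 < a) (hB : ∀ t, ‖ψ t‖ ≤ B) (z : ℍ) :
    ‖incEisCusp Γ σ ψ z‖ ≤ B * (1 + 36 / a) := by
  have hle : ConjAct.toConjAct (Matrix.SpecialLinearGroup.toGL σ : GL (Fin 2) ℝ)⁻¹ • Γ ≤
      (Matrix.SpecialLinearGroup.toGL : SL(2, ℝ) →* GL (Fin 2) ℝ).range := by
    rw [← map_inv]; exact conj_le_range hΓ σ⁻¹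
  exact norm_incEis_le hle (hd.conj _) (upperRightHom_one_mem_of_periods hper) hψ ha hB _

/-- **`E(z|ψ)` high in the cusp is `ψ(y)`**: if `ψ = 0` on `(-∞, a)` and `Im z > 1/a` then
`E(z|ψ) = ψ(Im z)` (`-1 ∈ Γ`, width one: the rows `(0, ±1)` give `ψ(y)`, every other row has height
`≤ 1/y < a`). With `incEis_eq_zero_of_lt_im`: in the cuspidal zone an incomplete Eisenstein series
IS its constant term — the identity behind truncation by subtracting constant terms.
[cite: Iwaniec2002, §3.2 (3.12) & (3.16), PDF pp. 43–44; §6.4 (6.29), PDF p. 88] -/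
theorem incEis_eq_of_lt_im
    (hΓ : Γ ≤ (Matrix.SpecialLinearGroup.toGL : SL(2, ℝ) →* GL (Fin 2) ℝ).range)
    (hneg : (-1 : GL (Fin 2) ℝ) ∈ Γ) (hd : IsDiscreteSubgroup Γ)
    (hT : Matrix.GeneralLinearGroup.upperRightHom (1 : ℝ) ∈ Γ)
    {ψ : ℝ → ℂ} {a : ℝ} (ha : 0 < a) (hψa : ∀ t < a, ψ t = 0) {z : ℍ} (hz : 1 / a < z.im) :
    incEis Γ ψ z = ψ z.im := by
  classical
  set r₁ : rows Γ := ⟨((1 : GL (Fin 2) ℝ) : Matrix (Fin 2) (Fin 2) ℝ) 1, row_mem_rows Γ.one_mem⟩ with hr₁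
  set r₂ : rows Γ := ⟨((-1 : GL (Fin 2) ℝ) : Matrix (Fin 2) (Fin 2) ℝ) 1, row_mem_rows hneg⟩ with hr₂
  have hr₁0 : r₁.1 0 = 0 := by simp [hr₁]
  have hr₁1 : r₁.1 1 = 1 := by simp [hr₁]
  have hr₂0 : r₂.1 0 = 0 := by simp [hr₂, Units.val_neg]
  have hr₂1 : r₂.1 1 = -1 := by simp [hr₂, Units.val_neg]
  have hne : r₁ ≠ r₂ := by
    intro h
    have := congrArg (fun r : rows Γ => r.1 1) h
    simp only [hr₁1, hr₂1] at this
    norm_num at this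
  have him : ∀ r : rows Γ, r.1 0 = 0 → (r.1 1 = 1 ∨ r.1 1 = -1) → rowIm r.1 z = z.im := by
    intro r h0 h1
    rw [rowIm, normSq_rowDenom, h0]
    rcases h1 with h | h <;> simp [h]
  set s₀ : Finset (rows Γ) := {r₁, r₂} with hs₀
  have hzero : ∀ r : rows Γ, r ∉ s₀ → ψ (rowIm r.1 z) = 0 := by
    intro r hr
    have h0 : r.1 0 ≠ 0 := by
      intro h0
      apply hr
      rcases apply_one_eq_of_mem_rows hΓ hd hT r.2 h0 with h1 | h1
      · have : r = r₁ := Subtype.ext (funext fun j => by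
          fin_cases j
          · simp [h0, hr₁0]
          · simp [h1, hr₁1])
        simp [hs₀, this]
      · have : r = r₂ := Subtype.ext (funext fun j => by
          fin_cases j
          · simp [h0, hr₂0]
          · simp [h1, hr₂1])
        simp [hs₀, this]
    refine hψa _ (lt_of_le_of_lt (rowIm_le_inv_im hΓ hd hT r.2 h0 z) ?_)
    have hy := z.im_pos
    rw [div_lt_iff₀ hy]
    rw [div_lt_iff₀ ha] at hz
    linarith
  unfold incEis
  rw [tsum_eq_sum hzero, hs₀, Finset.sum_pair hne, him r₁ hr₁0 (Or.inl hr₁1),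
    him r₂ hr₂0 (Or.inr hr₂1)]
  ring

/-- The same at the cusp `𝔞 = σ∞`: `E_𝔞(z|ψ) = ψ(Im σ⁻¹z)` for `Im σ⁻¹z > 1/a`. [cite: Iwaniec2002, §3.2 (3.16), PDF p. 44] -/
theorem incEisCusp_eq_of_lt_im
    (hΓ : Γ ≤ (Matrix.SpecialLinearGroup.toGL : SL(2, ℝ) →* GL (Fin 2) ℝ).range)
    (hneg : (-1 : GL (Fin 2) ℝ) ∈ Γ) (hd : IsDiscreteSubgroup Γ) (σ : SL(2, ℝ))
    (hper : (ConjAct.toConjAct (Matrix.SpecialLinearGroup.toGL σ : GL (Fin 2) ℝ)⁻¹ • Γ).strictPeriods =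
      AddSubgroup.zmultiples 1)
    {ψ : ℝ → ℂ} {a : ℝ} (ha : 0 < a) (hψa : ∀ t < a, ψ t = 0) {z : ℍ} (hz : 1 / a < (σ⁻¹ • z).im) :
    incEisCusp Γ σ ψ z = ψ (σ⁻¹ • z).im := by
  have hle : ConjAct.toConjAct (Matrix.SpecialLinearGroup.toGL σ : GL (Fin 2) ℝ)⁻¹ • Γ ≤
      (Matrix.SpecialLinearGroup.toGL : SL(2, ℝ) →* GL (Fin 2) ℝ).range := by
    rw [← map_inv]; exact conj_le_range hΓ σ⁻¹
  exact incEis_eq_of_lt_im hle ((neg_one_mem_conj_iff _).mpr hneg) (hd.conj _)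
    (upperRightHom_one_mem_of_periods hper) ha hψa hz

/-- … and `E_𝔞(z|ψ) = 0` for `Im σ⁻¹z > max b (1/a)` when `supp ψ ⊆ [a, b]`. [cite: Iwaniec2002, §3.2, PDF p. 43] -/
theorem incEisCusp_eq_zero_of_lt_im
    (hΓ : Γ ≤ (Matrix.SpecialLinearGroup.toGL : SL(2, ℝ) →* GL (Fin 2) ℝ).range)
    (hd : IsDiscreteSubgroup Γ) (σ : SL(2, ℝ))
    (hper : (ConjAct.toConjAct (Matrix.SpecialLinearGroup.toGL σ : GL (Fin 2) ℝ)⁻¹ • Γ).strictPeriods =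
      AddSubgroup.zmultiples 1)
    {ψ : ℝ → ℂ} {a b : ℝ} (ha : 0 < a) (hψa : ∀ t < a, ψ t = 0) (hψb : ∀ t > b, ψ t = 0)
    {z : ℍ} (hz : max b (1 / a) < (σ⁻¹ • z).im) : incEisCusp Γ σ ψ z = 0 := by
  have hle : ConjAct.toConjAct (Matrix.SpecialLinearGroup.toGL σ : GL (Fin 2) ℝ)⁻¹ • Γ ≤
      (Matrix.SpecialLinearGroup.toGL : SL(2, ℝ) →* GL (Fin 2) ℝ).range := by
    rw [← map_inv]; exact conj_le_range hΓ σ⁻¹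
  exact incEis_eq_zero_of_lt_im hle (hd.conj _) (upperRightHom_one_mem_of_periods hper) ha hψa hψb hz

/-! ### Lemma 3.3 at the cusp `𝔞`: `∫_F E_𝔞(z|ψ) f(z) dμ = ∫₀^∞ ψ(y) f_𝔞(y) y⁻² dy` -/

/-- Conjugation `γ ↦ S⁻¹γS` as a bijection `Γ ≃ S⁻¹ΓS`. [folklore] -/
def conjEquiv (S : GL (Fin 2) ℝ) : Γ ≃ (ConjAct.toConjAct S⁻¹ • Γ : Subgroup (GL (Fin 2) ℝ)) where
  toFun γ := ⟨S⁻¹ * γ * S, by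
    rw [mem_conj_inv_iff]
    simp [mul_assoc]⟩
  invFun γ' := ⟨S * γ' * S⁻¹, (mem_conj_inv_iff S γ').mp γ'.2⟩
  left_inv γ := by ext1; simp [mul_assoc]
  right_inv γ' := by ext1; simp [mul_assoc]

/-- Value of `conjEquiv`. [folklore] -/
theorem coe_conjEquiv (S : GL (Fin 2) ℝ) (γ : Γ) : ((conjEquiv S γ : (ConjAct.toConjAct S⁻¹ • Γ : Subgroup (GL (Fin 2) ℝ))) : GL (Fin 2) ℝ) = S⁻¹ * γ * S := rfl

/-- **The unfolding identity at a cusp, pointwise**: for `f` automorphic,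
`Σ_{γ ∈ Γ} 𝟙_P(σ⁻¹γz) ψ(Im σ⁻¹γz) f(γz) = 2 E_𝔞(z|ψ) f(z)` (`P = {0 ≤ Re < 1}`).
[cite: Iwaniec2002, Lemma 3.3 (proof), PDF p. 44] -/
theorem tsum_strip_smul_eq_cusp
    (hΓ : Γ ≤ (Matrix.SpecialLinearGroup.toGL : SL(2, ℝ) →* GL (Fin 2) ℝ).range)
    (hd : IsDiscreteSubgroup Γ) (σ : SL(2, ℝ))
    (hper : (ConjAct.toConjAct (Matrix.SpecialLinearGroup.toGL σ : GL (Fin 2) ℝ)⁻¹ • Γ).strictPeriods =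
      AddSubgroup.zmultiples 1)
    (ψ : ℝ → ℂ) {f : ℍ → ℂ} (hfa : IsAutomorphic Γ f) (z : ℍ) :
    ∑' γ : Γ, (cuspStrip 0).indicator (fun _ => (1 : ℂ)) (σ⁻¹ • (γ : GL (Fin 2) ℝ) • z) *
        (ψ (σ⁻¹ • (γ : GL (Fin 2) ℝ) • z).im * f ((γ : GL (Fin 2) ℝ) • z)) =
      2 * (incEisCusp Γ σ ψ z * f z) := by
  set S : GL (Fin 2) ℝ := Matrix.SpecialLinearGroup.toGL σ with hS
  set Γ' : Subgroup (GL (Fin 2) ℝ) := ConjAct.toConjAct S⁻¹ • Γ with hΓ'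
  have hΓ'le : Γ' ≤ (Matrix.SpecialLinearGroup.toGL : SL(2, ℝ) →* GL (Fin 2) ℝ).range := by
    rw [hΓ', hS, ← map_inv]; exact conj_le_range hΓ σ⁻¹
  have hd' : IsDiscreteSubgroup Γ' := hd.conj _
  set f' : ℍ → ℂ := fun v => f (σ • v) with hf'
  have e1 : ∀ w : ℍ, σ⁻¹ • w = S⁻¹ • w := fun w => by rw [hS, ← map_inv]; rfl
  have hf'a : IsAutomorphic Γ' f' := by
    intro γ' hγ' v
    have hδ : S * γ' * S⁻¹ ∈ Γ := (mem_conj_inv_iff S γ').mp hγ'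
    simp only [hf']
    have e : σ • γ' • v = (S * γ' * S⁻¹) • (σ • v) := by
      rw [← toGL_smul_eq, ← toGL_smul_eq, mul_smul, mul_smul, inv_smul_smul]
    rw [e, hfa _ hδ]
  have h := tsum_strip_smul_eq hΓ'le hd' hper ψ hf'a (σ⁻¹ • z)
  have ef : f' (σ⁻¹ • z) = f z := by simp only [hf', smul_inv_smul]
  rw [ef] at h
  rw [show incEisCusp Γ σ ψ z = incEis Γ' ψ (σ⁻¹ • z) from rfl, ← h]
  -- reindex `Γ ≃ Γ'`
  rw [← (conjEquiv S).tsum_eq]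
  refine tsum_congr fun γ => ?_
  have e : ((conjEquiv S γ : Γ') : GL (Fin 2) ℝ) • (σ⁻¹ • z) = σ⁻¹ • (γ : GL (Fin 2) ℝ) • z := by
    rw [coe_conjEquiv, e1, e1, mul_smul, mul_smul, smul_inv_smul]
  rw [e]
  simp only [hf']
  rw [smul_inv_smul]

/-- Transport of the strip function by `σ` keeps integrability. [folklore] -/
theorem integrable_comp_sl_inv_smul {Φ₀ : ℍ → ℂ} (hΦ₀ : Integrable Φ₀) (σ : SL(2, ℝ)) :
    Integrable fun v : ℍ => Φ₀ (σ⁻¹ • v) := by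
  have h := integrable_comp_smul hΦ₀ ((Matrix.SpecialLinearGroup.toGL σ : GL (Fin 2) ℝ))⁻¹
  refine h.congr (Eventually.of_forall fun v => ?_)
  simp only
  rw [← map_inv]; rfl

/-- `∫_ℍ Φ₀(σ⁻¹v) dμ(v) = ∫_ℍ Φ₀ dμ` (invariance of the hyperbolic measure). [cite: Iwaniec2002, (1.8), PDF p. 10] -/
theorem integral_comp_sl_inv_smul (Φ₀ : ℍ → ℂ) (σ : SL(2, ℝ)) :
    ∫ v : ℍ, Φ₀ (σ⁻¹ • v) = ∫ v : ℍ, Φ₀ v := by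
  have h := (measurePreserving_smul ((Matrix.SpecialLinearGroup.toGL σ : GL (Fin 2) ℝ))⁻¹
    (volume : Measure ℍ)).integral_comp
    (MeasurableEquiv.smul (((Matrix.SpecialLinearGroup.toGL σ : GL (Fin 2) ℝ))⁻¹ : GL (Fin 2) ℝ)).measurableEmbedding Φ₀
  rw [← h]
  refine integral_congr_ae (Eventually.of_forall fun v => ?_)
  simp only
  rw [← map_inv]; rfl

/-- **Iwaniec, Lemma 3.3 at an arbitrary cusp `𝔞 = σ∞`.** Let `Γ ≤ SL₂(ℝ)` (inside `GL₂(ℝ)`)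
be discrete with `-1 ∈ Γ`, `F` a fundamental domain, `σ` a scaling matrix of the cusp `𝔞` with
`σ⁻¹Γ_𝔞σ = B` (periods of `σ⁻¹Γσ` exactly `ℤ`, `Fuchsian.exists_scaling`), `ψ` continuous with
support in `[a, b] ⊆ (0, ∞)` and `f` automorphic and continuous. Then
`∫_F E_𝔞(z|ψ) f(z) dμ(z) = ∫₀^∞ ψ(y) f_𝔞(y) y⁻² dy`, `f_𝔞(y) = ∫₀¹ f(σ(x + iy)) dx` the zero-th
Fourier coefficient of `f` at `𝔞` (`Fuchsian.cuspMeanAt σ f`, (3.2)–(3.3)); printed with `f̄`.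
[cite: Iwaniec2002, Lemma 3.3 (3.14), PDF p. 44] -/
theorem setIntegral_incEisCusp_mul
    (hΓ : Γ ≤ (Matrix.SpecialLinearGroup.toGL : SL(2, ℝ) →* GL (Fin 2) ℝ).range)
    (hneg : (-1 : GL (Fin 2) ℝ) ∈ Γ) (hd : IsDiscreteSubgroup Γ) {F : Set ℍ}
    (hF : IsHypFundamentalDomain Γ F) (σ : SL(2, ℝ))
    (hper : (ConjAct.toConjAct (Matrix.SpecialLinearGroup.toGL σ : GL (Fin 2) ℝ)⁻¹ • Γ).strictPeriods =
      AddSubgroup.zmultiples 1)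
    {ψ : ℝ → ℂ} (hψc : Continuous ψ) {a b : ℝ} (ha : 0 < a)
    (hψa : ∀ t < a, ψ t = 0) (hψb : ∀ t > b, ψ t = 0) {f : ℍ → ℂ} (hfa : IsAutomorphic Γ f)
    (hfc : Continuous f) :
    ∫ z in F, incEisCusp Γ σ ψ z * f z =
      ∫ y in Set.Ioi (0 : ℝ), (ψ y * (((y ^ 2)⁻¹ : ℝ) : ℂ)) *
        cuspMeanAt σ f (UpperHalfPlane.ofComplex ⟨0, y⟩) := by
  set f' : ℍ → ℂ := fun v => f (σ • v) with hf'
  have hf'c : Continuous f' := hfc.comp (continuous_const_smul σ)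
  set Φ₀ : ℍ → ℂ := fun w => (cuspStrip 0).indicator (fun _ => (1 : ℂ)) w * (ψ w.im * f' w) with hΦ₀
  have hΦ₀i : Integrable Φ₀ := integrable_strip_mul hψc ha hψa hψb hf'c
  set Φ : ℍ → ℂ := fun v => Φ₀ (σ⁻¹ • v) with hΦ
  have hΦi : Integrable Φ := integrable_comp_sl_inv_smul hΦ₀i σ
  have hunf := setIntegral_tsum_smul_eq hΓ hneg hd.countable hF hΦi
  have hpt : ∀ z : ℍ, incEisCusp Γ σ ψ z * f z = (1 / 2) * ∑' γ : Γ, Φ ((γ : GL (Fin 2) ℝ) • z) := by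
    intro z
    have h := tsum_strip_smul_eq_cusp hΓ hd σ hper ψ hfa z
    have e : (fun γ : Γ => Φ ((γ : GL (Fin 2) ℝ) • z)) = fun γ : Γ =>
        (cuspStrip 0).indicator (fun _ => (1 : ℂ)) (σ⁻¹ • (γ : GL (Fin 2) ℝ) • z) *
          (ψ (σ⁻¹ • (γ : GL (Fin 2) ℝ) • z).im * f ((γ : GL (Fin 2) ℝ) • z)) := by
      funext γ
      simp only [hΦ, hΦ₀, hf', smul_inv_smul]
    rw [e, h]; ring
  simp_rw [hpt]
  rw [integral_const_mul, hunf, hΦ, integral_comp_sl_inv_smul Φ₀ σ, hΦ₀,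
    integral_strip_mul_eq hψc ha hψa hψb hf'c]
  rw [show (1 / 2 : ℂ) * (2 * _) = _ from by ring]
  rfl

/-- **Corollary (`f = 1`)**: `∫_F E_𝔞(z|ψ) dμ(z) = ∫₀^∞ ψ(y) y⁻² dy`. [cite: Iwaniec2002, Lemma 3.3, PDF p. 44] -/
theorem setIntegral_incEisCusp
    (hΓ : Γ ≤ (Matrix.SpecialLinearGroup.toGL : SL(2, ℝ) →* GL (Fin 2) ℝ).range)
    (hneg : (-1 : GL (Fin 2) ℝ) ∈ Γ) (hd : IsDiscreteSubgroup Γ) {F : Set ℍ}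
    (hF : IsHypFundamentalDomain Γ F) (σ : SL(2, ℝ))
    (hper : (ConjAct.toConjAct (Matrix.SpecialLinearGroup.toGL σ : GL (Fin 2) ℝ)⁻¹ • Γ).strictPeriods =
      AddSubgroup.zmultiples 1)
    {ψ : ℝ → ℂ} (hψc : Continuous ψ) {a b : ℝ} (ha : 0 < a)
    (hψa : ∀ t < a, ψ t = 0) (hψb : ∀ t > b, ψ t = 0) :
    ∫ z in F, incEisCusp Γ σ ψ z = ∫ y in Set.Ioi (0 : ℝ), ψ y * (((y ^ 2)⁻¹ : ℝ) : ℂ) := by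
  have h := setIntegral_incEisCusp_mul hΓ hneg hd hF σ hper hψc ha hψa hψb (f := fun _ => (1 : ℂ))
    (isAutomorphic_const Γ 1) continuous_const
  simp only [mul_one] at h
  rw [h]
  refine setIntegral_congr_fun measurableSet_Ioi fun y _ => ?_
  simp [cuspMeanAt, cuspMean]

end Cusp

/-! ## The Mellin representation (7.2) of incomplete Eisenstein series -/

section Mellin

open _root_.MeasureTheory _root_.Set _root_.Filter _root_.Real
open scoped _root_.Pointwise _root_.ENNReal _root_.Topology

/-- **(7.2): `E(z|ψ) = (1/2πi) ∫_{(c)} ψ̂(s) E_∞(z, s) ds` for `c > 1`**, with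
`ψ̂(s) = ∫₀^∞ ψ(y) y^{-s-1} dy = Mψ(-s)` (Mathlib's `mellin`); on the line `s = c - iτ` this reads
`E(z|ψ) = (1/2π) ∫_ℝ Mψ(-c + iτ) E_∞(z, c - iτ) dτ`. Here `Γ ≤ SL₂(ℝ)` is discrete with the cusp
`∞` of width one and `ψ` is a smooth bump on `(0, ∞)` (`IsSmoothBump`): insert the Mellin inversion
formula for `ψ` (`IsSmoothBump.mellin_inversion`, on `Re = -c`) into (3.12) and interchange the sum
over `Γ_∞\Γ` with the integral, which is absolutely convergent by the decay (7.3) of `Mψ` and the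
convergence of `E_∞(z, c)` (`summable_rowIm_rpow`). [cite: Iwaniec2002, §7 (7.2)–(7.3) & §3.2 (3.12), PDF pp. 73–74, 43] -/
theorem incEis_eq_integral_mellin
    (hΓ : Γ ≤ (Matrix.SpecialLinearGroup.toGL : SL(2, ℝ) →* GL (Fin 2) ℝ).range)
    (hd : IsDiscreteSubgroup Γ) (hT : Matrix.GeneralLinearGroup.upperRightHom (1 : ℝ) ∈ Γ)
    {ψ : ℝ → ℝ} (hψ : IsSmoothBump ψ) {c : ℝ} (hc : 1 < c) (z : ℍ) :
    incEis Γ (cplx ψ) z =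
      ((1 / (2 * π) : ℝ) : ℂ) * ∫ τ : ℝ, mellin (cplx ψ) (-(c : ℂ) + τ * Complex.I) *
        eisInfty Γ z ((c : ℂ) - τ * Complex.I) := by
  haveI : Countable (rows Γ) := ((hd.countable).image _).to_subtype
  set C₀ : ℂ := ((1 / (2 * π) : ℝ) : ℂ) with hC₀
  set m : ℝ → ℂ := fun τ => mellin (cplx ψ) (-(c : ℂ) + τ * Complex.I) with hm
  set Fr : rows Γ → ℝ → ℂ := fun r τ =>
    m τ * (((rowIm r.1 z : ℝ) : ℂ) ^ ((c : ℂ) - τ * Complex.I)) with hFr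
  -- Mellin inversion, row by row
  have hinv : ∀ r : rows Γ, cplx ψ (rowIm r.1 z) = C₀ * ∫ τ, Fr r τ := by
    intro r
    have h := hψ.mellin_inversion (-c) (rowIm_pos (ne_zero_of_mem_rows r.2) z)
    rw [h, hC₀]
    congr 1
    refine integral_congr_ae (Eventually.of_forall fun τ => ?_)
    simp only [hFr, hm]
    rw [mul_comm]
    congr 2
    · push_cast; ring
    · push_cast; ring
  -- integrability in `τ` and summability over the rows
  have hmi : Integrable m := by
    have h := hψ.verticalIntegrable_mellin (-c)
    rw [Complex.VerticalIntegrable] at h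
    refine h.congr (Eventually.of_forall fun τ => ?_)
    simp only [hm]; push_cast; ring_nf
  have hnormF : ∀ (r : rows Γ) (τ : ℝ), ‖Fr r τ‖ = ‖m τ‖ * rowIm r.1 z ^ c := by
    intro r τ
    simp only [hFr]
    rw [norm_mul, Complex.norm_cpow_eq_rpow_re_of_pos (rowIm_pos (ne_zero_of_mem_rows r.2) z)]
    simp
  have hFc : ∀ r : rows Γ, Continuous fun τ : ℝ => (((rowIm r.1 z : ℝ) : ℂ) ^ ((c : ℂ) - τ * Complex.I)) := by
    intro r
    have hpos : 0 < rowIm r.1 z := rowIm_pos (ne_zero_of_mem_rows r.2) z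
    refine Continuous.const_cpow (by fun_prop) (Or.inl ?_)
    exact_mod_cast hpos.ne'
  have hFint : ∀ r : rows Γ, Integrable (Fr r) := by
    intro r
    refine (hmi.mul_bdd (c := rowIm r.1 z ^ c) (hFc r).aestronglyMeasurable
      (Eventually.of_forall fun τ => ?_)).congr (Eventually.of_forall fun τ => by simp only [hFr])
    rw [Complex.norm_cpow_eq_rpow_re_of_pos (rowIm_pos (ne_zero_of_mem_rows r.2) z)]
    simp
  have hFsum : Summable fun r : rows Γ => ∫ τ, ‖Fr r τ‖ := by
    simp_rw [hnormF, integral_mul_const]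
    exact (summable_rowIm_rpow hΓ hd hT z hc).mul_left _
  have hswap := integral_tsum_of_summable_integral_norm hFint hFsum
  have hinner : ∀ τ : ℝ, ∑' r : rows Γ, Fr r τ = 2 * (m τ * eisInfty Γ z ((c : ℂ) - τ * Complex.I)) := by
    intro τ
    simp only [hFr]
    rw [tsum_mul_left]
    unfold eisInfty eisTerm
    ring
  unfold incEis
  simp_rw [hinv]
  rw [tsum_mul_left, hswap]
  simp_rw [hinner]
  rw [integral_const_mul]
  ring

/-- **(7.2) at an arbitrary cusp `𝔞 = σ∞`**: `E_𝔞(z|ψ) = (1/2π) ∫ Mψ(-c + iτ) E_𝔞(z, c - iτ) dτ`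
(`c > 1`; `E_𝔞 = eisCusp Γ σ`, `σ⁻¹Γσ` with the cusp `∞` of width one).
[cite: Iwaniec2002, §7 (7.1)–(7.2), PDF pp. 73–74] -/
theorem incEisCusp_eq_integral_mellin
    (hΓ : Γ ≤ (Matrix.SpecialLinearGroup.toGL : SL(2, ℝ) →* GL (Fin 2) ℝ).range)
    (hd : IsDiscreteSubgroup Γ) (σ : SL(2, ℝ))
    (hper : (ConjAct.toConjAct (Matrix.SpecialLinearGroup.toGL σ : GL (Fin 2) ℝ)⁻¹ • Γ).strictPeriods =
      AddSubgroup.zmultiples 1)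
    {ψ : ℝ → ℝ} (hψ : IsSmoothBump ψ) {c : ℝ} (hc : 1 < c) (z : ℍ) :
    incEisCusp Γ σ (cplx ψ) z =
      ((1 / (2 * π) : ℝ) : ℂ) * ∫ τ : ℝ, mellin (cplx ψ) (-(c : ℂ) + τ * Complex.I) *
        eisCusp Γ σ z ((c : ℂ) - τ * Complex.I) := by
  have hle : ConjAct.toConjAct (Matrix.SpecialLinearGroup.toGL σ : GL (Fin 2) ℝ)⁻¹ • Γ ≤
      (Matrix.SpecialLinearGroup.toGL : SL(2, ℝ) →* GL (Fin 2) ℝ).range := by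
    rw [← map_inv]; exact conj_le_range hΓ σ⁻¹
  exact incEis_eq_integral_mellin hle (hd.conj _) (upperRightHom_one_mem_of_periods hper) hψ hc (σ⁻¹ • z)

end Mellin

end Fuchsian

end Literature.NumberTheory.Automorphic

end
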